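import Literature.NumberTheory.Automorphic.StrongApproximationSLn
import Mathlib.RingTheory.DedekindDomain.SInteger
import HarnessLib

/-!
# S-arithmetic strong approximation: `SL_n(𝓞_{K,S})` is dense in `∏_{v ∈ S} SL_n(K_v)`

Topic `NumberTheory/Automorphic`; namespace `Literature.NumberTheory.Automorphic`.  KERNEL ONLY: theorems, no
definition, no named fact, no instance, no `sorry`.  Fourth instalment of the tree's strong approximation files
(`StrongApproximationSL2` / `StrongApproximationSLn` / `StrongApproximationSp`: density of `G(K)` in `G(𝔸_K^∞)`),
now in the `S`-ARITHMETIC form in which Tate-style arguments consume it ([PlatonovRapinchuk1994] §7.4, Thm. 7.12 with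
the excluded set `∞`; [CasselsFrohlichANT1967] Ch. II §15): for a Dedekind domain `R` with fraction field `K` and ANY
set `S` of non-zero primes of `R` (Mathlib `HeightOneSpectrum R`),

* `denseRange_algebraMap_sInteger_pi` — **the `S`-integers `𝓞_{K,S} = {x ∈ K | v(x) ≤ 1 for all v ∉ S}` (Mathlib
  `Set.integer S K`) are dense in `∏_{v ∈ S} K_v`** (product topology; for infinite `S` this is harmless — a basic open
  set constrains finitely many coordinates): strong approximation for the additive group, read off the tree's
  `denseRange_algebraMap_finiteAdeleRing` (`K` dense in `𝔸_K^∞`) on the open subset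
  `∏_{v ∈ S} K_v × ∏_{w ∉ S} 𝒪_w ⊆ 𝔸_K^∞` (`FiniteAdeleRing.isOpen_setOf_integral_outside`, Mathlib
  `RestrictedProduct.isOpen_forall_imp_mem`);
* `denseRange_specialLinearGroup_map_sInteger_pi` — **`SL_n(𝓞_{K,S})` is dense in `∏_{v ∈ S} SL_n(K_v)`** for every
  finite index type (no rank hypothesis: the tree's `SLnElementary.eq_top_of_transvection_mem` inducts from `n = 0`):
  the closure `H` of the image is a closed subgroup; by the first result and the continuity of `x ↦ 1 + x E_{ij}` it
  contains, at each `v₀ ∈ S`, every elementary matrix of `SL_n(K_{v₀})` placed at `v₀` (`1` elsewhere), hence the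
  whole factor `SL_n(K_{v₀})` (fields have unit pivots, `SLnElementary.eq_top_of_transvection_mem`), hence every
  finitely supported element, and these are dense in the product topology;
* `exists_specialLinearGroup_sInteger_mem_of_isOpen` — the working form: every non-empty open subset of
  `∏_{v ∈ S} SL_n(K_v)` contains the image of an `S`-integral matrix of determinant one.

For `K` a number field and `S = {v ∣ ℓ}` this is «`SL_r(𝓞_K[1/ℓ])` is dense in `∏_{v ∣ ℓ} SL_r(K_v)`», the input of
Tate's freeness criterion for `ℤ_ℓ ⊗ 𝓞_K`-lattices used in the global half of Faltings' argument (cell `hodgecm-mathlib`,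
T5 §6.5; banked generic capital, books 0).  HC_CM is proved only modulo the 7 printed citations until rung 0 closes.

## References
* V. Platonov, A. Rapinchuk, *Algebraic groups and number theory* (1994), §7.4 Thm. 7.12; §1.2 (S-integers)
  [PlatonovRapinchuk1994].
* J. W. S. Cassels, A. Fröhlich (eds.), *Algebraic Number Theory* (1967), Ch. II §15 (strong approximation for the
  adele ring) [CasselsFrohlichANT1967].
-/

set_option autoImplicit false

noncomputable section

open Matrix IsDedekindDomain IsDedekindDomain.HeightOneSpectrum
open scoped MatrixGroups

namespace Literature.NumberTheory.Automorphic

variable (R : Type*) [CommRing R] [IsDedekindDomain R] (K : Type*) [Field K] [Algebra R K]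
  [IsFractionRing R K]

/-! ### §1. The `S`-integers are dense in `∏_{v ∈ S} K_v` -/

section Integers

variable (S : Set (HeightOneSpectrum R))

/-- The finite adeles integral outside `S`, `∏_{v ∈ S} K_v × ∏_{w ∉ S} 𝒪_w ⊆ 𝔸_K^∞` (an arbitrary — possibly
infinite — union of the basic open subrings `𝔸_K^T`), form an OPEN subset of the finite adele ring (Mathlib
`RestrictedProduct.isOpen_forall_imp_mem`: each `𝒪_w` is open). [cite: CasselsFrohlichANT1967, Ch. II §14 (restricted topological product)] -/
theorem FiniteAdeleRing.isOpen_setOf_integral_outside :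
    IsOpen {a : FiniteAdeleRing R K | ∀ w, w ∉ S → a w ∈ w.adicCompletionIntegers K} :=
  RestrictedProduct.isOpen_forall_imp_mem fun v : HeightOneSpectrum R =>
    Valued.isOpen_valuationSubring (v.adicCompletion K)

/-- A field element is an `S`-integer iff it is a local integer at every place outside `S` (the completed valuation
restricts to the global one, Mathlib `valuedAdicCompletion_eq_valuation'`). [cite: PlatonovRapinchuk1994, §1.2 (the ring of S-integers)] -/
theorem mem_integer_iff_forall_coe_mem_adicCompletionIntegers (k : K) :
    k ∈ S.integer K ↔ ∀ w : HeightOneSpectrum R, w ∉ S → (k : w.adicCompletion K) ∈ w.adicCompletionIntegers K := by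
  refine forall₂_congr fun w _ => ?_
  rw [mem_adicCompletionIntegers, valuedAdicCompletion_eq_valuation']

/-- **The `S`-integers are dense in `∏_{v ∈ S} K_v`** (product topology; any set `S` of finite places, any Dedekind
domain): given finitely many places `v ∈ S`, targets `x_v ∈ K_v` and neighbourhoods, the open subset
«close to `x_v` at these `v`, integral at every `w ∉ S`» of `𝔸_K^∞` is non-empty (a finitely supported adele lies in
it), so it contains a global element (`denseRange_algebraMap_finiteAdeleRing`), which is then an `S`-integer with the
required approximations.  Strong approximation for the additive group with the excluded set `∞ ∪ S`.
[cite: CasselsFrohlichANT1967, Ch. II §15 (strong approximation theorem)] [cite: PlatonovRapinchuk1994, §1.2] -/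
theorem denseRange_algebraMap_sInteger_pi :
    DenseRange (fun x : S.integer K => fun v : S => ((x : K) : v.1.adicCompletion K)) := by
  classical
  intro x
  rw [mem_closure_iff]
  intro O hO hxO
  -- a basic open neighbourhood: finitely many coordinates `I`, open sets `u v ∋ x v`
  obtain ⟨I, u, hu, hIO⟩ := isOpen_pi_iff.1 hO x hxO
  -- a finitely supported adele with the coordinates `x v`, `v ∈ I`
  let a₀ : ∀ w : HeightOneSpectrum R, w.adicCompletion K :=
    fun w => ∑ v ∈ I, Pi.single (M := fun w : HeightOneSpectrum R => w.adicCompletion K) v.1 (x v) w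
  have ha₀I : ∀ v ∈ I, a₀ v.1 = x v := by
    intro v hv
    change ∑ v' ∈ I, Pi.single (M := fun w : HeightOneSpectrum R => w.adicCompletion K) v'.1 (x v') v.1 = x v
    rw [Finset.sum_eq_single_of_mem v hv]
    · exact Pi.single_eq_same _ _
    · intro v' _ hv'
      exact Pi.single_eq_of_ne (fun h => hv' (Subtype.ext h.symm)) _
  have ha₀0 : ∀ w, (∀ v ∈ I, v.1 ≠ w) → a₀ w = 0 := by
    intro w hw
    change ∑ v' ∈ I, Pi.single (M := fun w : HeightOneSpectrum R => w.adicCompletion K) v'.1 (x v') w = 0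
    exact Finset.sum_eq_zero fun v' hv' => Pi.single_eq_of_ne (hw v' hv').symm _
  have ha₀int : ∀ᶠ w in Filter.cofinite, a₀ w ∈ w.adicCompletionIntegers K := by
    refine (I.image Subtype.val).finite_toSet.compl_mem_cofinite |> Filter.mem_of_superset <| ?_
    intro w hw
    have hw' : ∀ v ∈ I, v.1 ≠ w := fun v hv h => hw (Finset.mem_image.2 ⟨v, hv, h⟩)
    change a₀ w ∈ w.adicCompletionIntegers K
    rw [ha₀0 w hw']
    exact zero_mem _
  let a : FiniteAdeleRing R K := ⟨a₀, ha₀int⟩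
  -- the open set «in `u v` at `v ∈ I`, integral outside `S`» contains `a`
  let W : Set (FiniteAdeleRing R K) :=
    {b | ∀ v ∈ I, b v.1 ∈ u v} ∩ {b | ∀ w, w ∉ S → b w ∈ w.adicCompletionIntegers K}
  have hWopen : IsOpen W := by
    refine IsOpen.inter ?_ (FiniteAdeleRing.isOpen_setOf_integral_outside R K S)
    have hW1 : {b : FiniteAdeleRing R K | ∀ v ∈ I, b v.1 ∈ u v} =
        ⋂ v ∈ I, (fun b : FiniteAdeleRing R K => b v.1) ⁻¹' u v := by
      ext b; simp only [Set.mem_setOf_eq, Set.mem_iInter, Set.mem_preimage]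
    rw [hW1]
    exact isOpen_biInter_finset fun v hv =>
      (hu v hv).1.preimage (RestrictedProduct.continuous_eval v.1)
  have haW : a ∈ W := by
    refine ⟨fun v hv => ?_, fun w hw => ?_⟩
    · change a₀ v.1 ∈ u v
      rw [ha₀I v hv]
      exact (hu v hv).2
    · change a₀ w ∈ w.adicCompletionIntegers K
      rw [ha₀0 w fun v _ h => hw (h ▸ v.2)]
      exact zero_mem _
  -- a global element in it
  obtain ⟨b, hbW, k, rfl⟩ := (denseRange_algebraMap_finiteAdeleRing R K).exists_mem_open hWopen ⟨a, haW⟩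
    |> fun ⟨k, hk⟩ => (⟨_, hk, k, rfl⟩ : ∃ b ∈ W, ∃ k : K, algebraMap K (FiniteAdeleRing R K) k = b)
  have hkS : k ∈ S.integer K :=
    (mem_integer_iff_forall_coe_mem_adicCompletionIntegers R K S k).2 fun w hw => hbW.2 w hw
  refine ⟨fun v : S => ((k : K) : v.1.adicCompletion K), hIO fun v hv => ?_, ⟨⟨k, hkS⟩, rfl⟩⟩
  exact hbW.1 v hv

end Integers

/-! ### §2. Fields have unit pivots; elementary matrices placed at one factor -/

section Pivot

/-- Over a field, a unimodular column can be given a unit pivot by one row operation: if the pivot entry is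
non-zero keep it, otherwise add `a_i⁻¹`-times a non-zero entry `a_i` to make it `1` (the hypothesis of the tree's
`SLnElementary.eq_top_of_transvection_mem` for fields). [folklore] -/
private theorem exists_isUnit_pivot_of_field {F : Type*} [Field F] (r : ℕ) (a c : Fin r ⊕ Unit → F)
    (hca : ∑ i, c i * a i = 1) :
    ∃ t : Fin r → F, IsUnit (a (Sum.inr ()) + ∑ i, t i * a (Sum.inl i)) := by
  classical
  by_cases hp : a (Sum.inr ()) ≠ 0
  · exact ⟨0, by simpa using hp⟩
  · rw [not_not] at hp
    -- some `a (inl i₀)` is non-zero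
    have hex : ∃ i₀, a (Sum.inl i₀) ≠ 0 := by
      by_contra h
      push Not at h
      have h0 : ∑ i, c i * a i = 0 := by
        refine Finset.sum_eq_zero fun i _ => ?_
        rcases i with i | ⟨⟩
        · rw [h i, mul_zero]
        · rw [hp, mul_zero]
      rw [h0] at hca
      exact zero_ne_one hca
    obtain ⟨i₀, hi₀⟩ := hex
    refine ⟨Pi.single i₀ (a (Sum.inl i₀))⁻¹, ?_⟩
    have hsum : ∑ i, Pi.single (M := fun _ : Fin r => F) i₀ (a (Sum.inl i₀))⁻¹ i * a (Sum.inl i) = 1 := by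
      rw [Finset.sum_eq_single i₀]
      · rw [Pi.single_eq_same, inv_mul_cancel₀ hi₀]
      · intro i _ hi
        rw [Pi.single_eq_of_ne hi, zero_mul]
      · intro h
        exact absurd (Finset.mem_univ i₀) h
    rw [hp, hsum, zero_add]
    exact isUnit_one

end Pivot

/-! ### §3. `SL_n(𝓞_{K,S})` is dense in `∏_{v ∈ S} SL_n(K_v)` -/

section SpecialLinear

variable (S : Set (HeightOneSpectrum R)) {ι : Type*} [Fintype ι] [DecidableEq ι]

/-- The closure of the image of `SL_n(𝓞_{K,S})` in `∏_{v ∈ S} SL_n(K_v)` contains, for each `v₀ ∈ S` and each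
elementary matrix `1 + x E_{ij}` of `SL_n(K_{v₀})`, the element equal to it at `v₀` and to `1` elsewhere:
`y ↦ (1 + y_v E_{ij})_v` is continuous on `∏_{v ∈ S} K_v`, carries the `S`-integers into the image, and the
`S`-integers are dense (`denseRange_algebraMap_sInteger_pi`). [cite: PlatonovRapinchuk1994, §7.4 Thm. 7.12 (proof)] -/
theorem mulSingle_transvection_mem_closure_range_sInteger [DecidableEq S] (v₀ : S) {i j : ι} (hij : i ≠ j)
    (x : v₀.1.adicCompletion K) :
    Pi.mulSingle (M := fun v : S => SpecialLinearGroup ι (v.1.adicCompletion K)) v₀ (SpecialLinearGroup.transvection hij x) ∈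
      closure (Set.range fun γ : SpecialLinearGroup ι (S.integer K) => fun v : S =>
        Matrix.SpecialLinearGroup.map
          ((algebraMap K (v.1.adicCompletion K)).comp (S.integer K).val.toRingHom) γ) := by
  classical
  -- the continuous map `T : y ↦ (1 + y_v E_{ij})_v`
  let T : (∀ v : S, v.1.adicCompletion K) → ∀ v : S, SpecialLinearGroup ι (v.1.adicCompletion K) :=
    fun y v => SpecialLinearGroup.transvection hij (y v)
  have hT : Continuous T :=
    continuous_pi fun v => (SpecialLinearGroup.continuous_transvection hij).comp (continuous_apply v)
  have hTx : T (Pi.single v₀ x) = Pi.mulSingle v₀ (SpecialLinearGroup.transvection hij x) := by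
    funext v
    by_cases hv : v = v₀
    · subst hv
      simp only [T, Pi.single_eq_same, Pi.mulSingle_eq_same]
    · simp only [T, Pi.single_eq_of_ne hv, Pi.mulSingle_eq_of_ne hv,
        SpecialLinearGroup.transvection_coeff_zero]
  rw [← hTx]
  refine map_mem_closure hT ((denseRange_algebraMap_sInteger_pi R K S).closure_range ▸ Set.mem_univ _) ?_
  rintro _ ⟨s, rfl⟩
  refine ⟨SpecialLinearGroup.transvection hij s, funext fun v => ?_⟩
  change SpecialLinearGroup.map _ (SpecialLinearGroup.transvection hij s) = SpecialLinearGroup.transvection hij _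
  rw [SpecialLinearGroup.map_transvection]
  rfl

/-- The closure of the image of `SL_n(𝓞_{K,S})` contains every element supported at one place `v₀ ∈ S`: it is a
closed subgroup containing all elementary matrices placed at `v₀`
(`mulSingle_transvection_mem_closure_range_sInteger`), and a field has unit pivots, so the tree's
`SLnElementary.eq_top_of_transvection_mem` applies to its preimage in `SL_n(K_{v₀})`.
[cite: PlatonovRapinchuk1994, §7.4 Thm. 7.12 (proof)] -/
theorem mulSingle_mem_topologicalClosure_range_sInteger [DecidableEq S] (v₀ : S)
    (g : SpecialLinearGroup ι (v₀.1.adicCompletion K)) :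
    Pi.mulSingle (M := fun v : S => SpecialLinearGroup ι (v.1.adicCompletion K)) v₀ g ∈
      ((MonoidHom.pi fun v : S => Matrix.SpecialLinearGroup.map (n := ι)
          ((algebraMap K (v.1.adicCompletion K)).comp (S.integer K).val.toRingHom)).range).topologicalClosure := by
  classical
  set Φ := (MonoidHom.pi fun v : S => Matrix.SpecialLinearGroup.map (n := ι)
    ((algebraMap K (v.1.adicCompletion K)).comp (S.integer K).val.toRingHom)) with hΦ
  -- the preimage of the closure under the embedding at `v₀` contains all transvections, hence is everything
  let H₀ : Subgroup (SpecialLinearGroup ι (v₀.1.adicCompletion K)) :=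
    Φ.range.topologicalClosure.comap
      (MonoidHom.mulSingle (fun v : S => SpecialLinearGroup ι (v.1.adicCompletion K)) v₀)
  have hH₀ : H₀ = ⊤ := by
    refine SLnElementary.eq_top_of_transvection_mem (fun r a c h => exists_isUnit_pivot_of_field r a c h) H₀
      fun i j hij c => ?_
    change Pi.mulSingle v₀ (SpecialLinearGroup.transvection hij c) ∈ Φ.range.topologicalClosure
    rw [← SetLike.mem_coe, Subgroup.topologicalClosure_coe, MonoidHom.coe_range]
    exact mulSingle_transvection_mem_closure_range_sInteger R K S v₀ hij c
  have hg : g ∈ H₀ := by rw [hH₀]; exact Subgroup.mem_top g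
  exact hg

/-- **`S`-arithmetic strong approximation for `SL_n`: `SL_n(𝓞_{K,S})` is dense in `∏_{v ∈ S} SL_n(K_v)`** for the
fraction field `K` of a Dedekind domain `R`, ANY set `S` of non-zero primes (product topology) and any finite index
type — [PlatonovRapinchuk1994] Thm. 7.12 for `G = SL_n` with the excluded set `∞` («`G(K)` is dense in `G(𝔸_K^S)`»),
projected to the places in `S`.  Proof: the closure `H` of the image is a closed subgroup containing every element
supported at a single place (`mulSingle_mem_topologicalClosure_range_sInteger`), hence every finitely supported
element, and those are dense in the product. [cite: PlatonovRapinchuk1994, §7.4 Thm. 7.12]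
[cite: CasselsFrohlichANT1967, Ch. II §15] -/
theorem denseRange_specialLinearGroup_map_sInteger_pi :
    DenseRange (fun γ : SpecialLinearGroup ι (S.integer K) => fun v : S =>
      Matrix.SpecialLinearGroup.map ((algebraMap K (v.1.adicCompletion K)).comp (S.integer K).val.toRingHom) γ) := by
  classical
  set Φ := (MonoidHom.pi fun v : S => Matrix.SpecialLinearGroup.map (n := ι)
    ((algebraMap K (v.1.adicCompletion K)).comp (S.integer K).val.toRingHom)) with hΦ
  let H : Subgroup (∀ v : S, SpecialLinearGroup ι (v.1.adicCompletion K)) := Φ.range.topologicalClosure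
  -- every finitely supported element lies in `H`
  have hfin : ∀ (g : ∀ v : S, SpecialLinearGroup ι (v.1.adicCompletion K)) (I : Finset S),
      (fun v => if v ∈ I then g v else 1) ∈ H := by
    intro g I
    induction I using Finset.induction_on with
    | empty =>
      have h1 : (fun v : S => if v ∈ (∅ : Finset S) then g v else 1) = 1 := by
        funext v; simp
      rw [h1]; exact H.one_mem
    | insert v₀ I hv₀ ih =>
      have hmul : (fun v : S => if v ∈ insert v₀ I then g v else 1) =
          Pi.mulSingle v₀ (g v₀) * fun v => if v ∈ I then g v else 1 := by
        funext v
        by_cases hv : v = v₀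
        · subst hv
          simp [hv₀]
        · have hv' : v ∈ insert v₀ I ↔ v ∈ I := by simp [hv]
          simp only [Pi.mul_apply, Pi.mulSingle_eq_of_ne hv, one_mul, hv']
      rw [hmul]
      exact H.mul_mem (mulSingle_mem_topologicalClosure_range_sInteger R K S v₀ (g v₀)) ih
  -- hence `H` is everything: finitely supported elements are dense and `H` is closed
  have htop : ∀ g : ∀ v : S, SpecialLinearGroup ι (v.1.adicCompletion K), g ∈ H := by
    intro g
    have hcl : g ∈ closure (H : Set (∀ v : S, SpecialLinearGroup ι (v.1.adicCompletion K))) := by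
      rw [mem_closure_iff]
      intro O hO hgO
      obtain ⟨I, u, hu, hIO⟩ := isOpen_pi_iff.1 hO g hgO
      refine ⟨fun v => if v ∈ I then g v else 1, hIO fun v hv => ?_, hfin g I⟩
      simp only [Finset.mem_coe] at hv
      simp only [hv, if_true]
      exact (hu v hv).2
    have hclosed : IsClosed (H : Set (∀ v : S, SpecialLinearGroup ι (v.1.adicCompletion K))) :=
      Subgroup.isClosed_topologicalClosure _
    rwa [hclosed.closure_eq] at hcl
  have hH : (H : Set (∀ v : S, SpecialLinearGroup ι (v.1.adicCompletion K))) = Set.univ :=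
    Set.eq_univ_of_forall htop
  have hrange : Set.range (fun γ : SpecialLinearGroup ι (S.integer K) => fun v : S =>
      Matrix.SpecialLinearGroup.map ((algebraMap K (v.1.adicCompletion K)).comp (S.integer K).val.toRingHom) γ) =
        (Φ.range : Set _) := by
    rw [MonoidHom.coe_range]; rfl
  refine dense_iff_closure_eq.2 ?_
  rw [hrange, ← Subgroup.topologicalClosure_coe, hH]

/-- **Working form**: every non-empty open subset of `∏_{v ∈ S} SL_n(K_v)` contains the image of some
`γ ∈ SL_n(𝓞_{K,S})` — e.g. for a number field and `S = {v ∣ ℓ}`, «`SL_r(𝓞_K[1/ℓ])` meets every open subset of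
`∏_{v ∣ ℓ} SL_r(K_v)`», the form Tate's freeness criterion for `ℤ_ℓ ⊗ 𝓞_K`-lattices uses.
[cite: PlatonovRapinchuk1994, §7.4 Thm. 7.12] -/
theorem exists_specialLinearGroup_sInteger_mem_of_isOpen
    (O : Set (∀ v : S, SpecialLinearGroup ι (v.1.adicCompletion K))) (hO : IsOpen O) (hne : O.Nonempty) :
    ∃ γ : SpecialLinearGroup ι (S.integer K),
      (fun v : S => Matrix.SpecialLinearGroup.map
        ((algebraMap K (v.1.adicCompletion K)).comp (S.integer K).val.toRingHom) γ) ∈ O :=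
  (denseRange_specialLinearGroup_map_sInteger_pi R K S).exists_mem_open hO hne

end SpecialLinear

end Literature.NumberTheory.Automorphic

end
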